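import Mathlib
import Literature.AlgebraicGeometry.Resolution.PointBlowupFlagInvariant
import Literature.AlgebraicGeometry.Resolution.PointBlowupHeightVectorDrops

/-!
# `WeightedInvariant.LocalWeightedDrop`, line `hasse-ridge-face-selection`: a first API for the Newton-polygon measures of a
# two-variable power series (`ordAlong`, `ordVarPS`, `degAlongPS`, `heightPS` of Hauser–Perlega / Hauser–Wagner, as typed in the tree)

Crux item stmt-ResolutionOfSingularities-8899 `LocalWeightedDrop` (route `ResolutionOfSingularities/WeightedInvariant`),
serving the door `WeightedConstruction` stmt-ResolutionOfSingularities-0571.  [OURS · L1 W4.3, chain w43, stub worker 3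
(gen 2): unit M1 of the S2iM attack plan (L/res-L1-w43-stub-3/S2iM-ATTACK-PLAN.md; SEAT TABLE v4 key S2iM
`stub_charTwoInseparableReductionWon` via Hauser–Wagner 2014 Thm 2(i)); elementary support bookkeeping for the Literature
DEFINITIONS `HauserPerlega2024.ordAlong`, `HauserWagner2014.ordVarPS` / `degAlongPS` / `heightPS`
(Literature/AlgebraicGeometry/Resolution/PointBlowupFlagInvariant.lean, PointBlowupHeightVectorDrops.lean), which the tree had
without lemmas; NOT a statement of any manuscript.]

* `ordAlong` (`⨅` of the `i`-exponents over the support, in `ℕ∞`): `ordAlong_le`, `le_ordAlong_iff`, `ordAlong_eq_top_iff`,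
  `exists_coeff_ne_zero_of_ordAlong` (the infimum is attained), `X_pow_dvd_iff_le_ordAlong` (`x_iⁿ ∣ H ↔ n ≤ ord_i H`),
  `ordAlong_mul_left_le` / `ordAlong_mul_of_isUnit` (units do not change it), `ordAlong_X_pow_mul` / `ordAlong_X_pow_mul_of_ne`,
  `ordAlong_of_constantCoeff_ne_zero`;
* `ordVarPS` (its `toNat`): `ordVarPS_coe`, `exists_coeff_apply_eq_ordVarPS`, `ordVarPS_le`;
* `degAlongPS` (the free exponent `α₁` of the highest vertex): `degAlongPS_le`, `exists_vertex` (the vertex `(α₁, ord_rig)` IS in the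
  support), `le_degAlongPS`, `apply_free_ge_of_apply_rig_eq` (on the lowest rigid row every free exponent is `≥ α₁`);
* `heightPS`: `ordVarPS_le_degAlongPS` and THE MONOMIAL CRITERION `heightPS_eq_zero_iff` — in GIVEN coordinates of `k[[x₀,x₁]]`,
  `height = 0` iff `H = x_free^a · x_rig^b · unit` (Hauser–Wagner: «f is not a monomial ⇔ height > 0», here coordinatewise).
-/

set_option linter.dupNamespace false -- mandated namespace of this single-conjunct summit

namespace Summit.ResolutionOfSingularities.ResolutionOfSingularities.Theorems

namespace InsepNewton

open MvPowerSeries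
open Literature.AlgebraicGeometry.Resolution
open Literature.AlgebraicGeometry.Resolution.HauserPerlega2024 (ordAlong)
open Literature.AlgebraicGeometry.Resolution.HauserWagner2014 (ordVarPS degAlongPS heightPS)

variable {K : Type} [Field K] {σ : Type}

/-! ### `ordAlong i H` — the least exponent of `x_i` over the support -/

/-- Unfolding `ordAlong` with `coeff`. -/
theorem ordAlong_def (i : σ) (H : MvPowerSeries σ K) :
    ordAlong i H = ⨅ (d : σ →₀ ℕ) (_ : coeff d H ≠ 0), ((d i : ℕ) : ℕ∞) := rfl

/-- A support point bounds `ordAlong` from above. -/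
theorem ordAlong_le {i : σ} {H : MvPowerSeries σ K} {d : σ →₀ ℕ} (h : coeff d H ≠ 0) : ordAlong i H ≤ (d i : ℕ∞) := by
  rw [ordAlong_def]
  exact iInf₂_le d h

/-- Lower bounds for `ordAlong`. -/
theorem le_ordAlong_iff {i : σ} {H : MvPowerSeries σ K} {n : ℕ∞} :
    n ≤ ordAlong i H ↔ ∀ d : σ →₀ ℕ, coeff d H ≠ 0 → n ≤ (d i : ℕ∞) := by
  rw [ordAlong_def]
  exact le_iInf₂_iff

/-- `ordAlong i H = ⊤` iff `H = 0`. -/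
theorem ordAlong_eq_top_iff {i : σ} {H : MvPowerSeries σ K} : ordAlong i H = ⊤ ↔ H = 0 := by
  constructor
  · intro h
    ext d
    by_contra hd
    have := ordAlong_le (i := i) hd
    rw [h, top_le_iff] at this
    exact ENat.coe_ne_top _ this
  · rintro rfl
    rw [ordAlong_def]
    simp

/-- THE INFIMUM IS ATTAINED: a non-zero series has a support point realising `ordAlong`. -/
theorem exists_coeff_ne_zero_of_ordAlong (i : σ) {H : MvPowerSeries σ K} (hH : H ≠ 0) :
    ∃ d : σ →₀ ℕ, coeff d H ≠ 0 ∧ ((d i : ℕ) : ℕ∞) = ordAlong i H := by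
  have hne : Nonempty {d : σ →₀ ℕ // coeff d H ≠ 0} := by
    by_contra h
    rw [not_nonempty_iff] at h
    apply hH
    ext d
    by_contra hd
    exact h.elim ⟨d, hd⟩
  obtain ⟨⟨d, hd⟩, h⟩ := ENat.exists_eq_iInf (fun x : {d : σ →₀ ℕ // coeff d H ≠ 0} => ((x.1 i : ℕ) : ℕ∞))
  refine ⟨d, hd, ?_⟩
  rw [h, ordAlong_def, iInf_subtype']

/-- DIVISIBILITY BY A POWER OF A VARIABLE: `x_iⁿ ∣ H ↔ n ≤ ord_i H`. -/
theorem X_pow_dvd_iff_le_ordAlong (i : σ) (n : ℕ) (H : MvPowerSeries σ K) :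
    X i ^ n ∣ H ↔ (n : ℕ∞) ≤ ordAlong i H := by
  rw [X_pow_dvd_iff, le_ordAlong_iff]
  constructor
  · intro h d hd
    by_contra hlt
    exact hd (h d (by exact_mod_cast not_le.mp hlt))
  · intro h d hd
    by_contra hne
    exact absurd (h d hne) (by exact_mod_cast not_le.mpr hd)

/-- A support point of a product lies above a support point of the right factor. -/
theorem exists_le_of_coeff_mul_ne_zero {U H : MvPowerSeries σ K} {d : σ →₀ ℕ} (h : coeff d (U * H) ≠ 0) :
    ∃ e : σ →₀ ℕ, e ≤ d ∧ coeff e H ≠ 0 := by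
  classical
  by_contra hcon
  push Not at hcon
  apply h
  rw [coeff_mul]
  refine Finset.sum_eq_zero fun p hp => ?_
  rw [Finset.HasAntidiagonal.mem_antidiagonal] at hp
  have hle : p.2 ≤ d := by rw [← hp]; exact le_add_self
  rw [hcon p.2 hle, mul_zero]

/-- Multiplication does not lower `ordAlong` of the other factor. -/
theorem ordAlong_mul_left_le (i : σ) (U H : MvPowerSeries σ K) : ordAlong i H ≤ ordAlong i (U * H) := by
  rw [le_ordAlong_iff]
  intro d hd
  obtain ⟨e, he, heH⟩ := exists_le_of_coeff_mul_ne_zero hd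
  exact le_trans (ordAlong_le heH) (by exact_mod_cast he i)

/-- UNITS DO NOT CHANGE `ordAlong`. -/
theorem ordAlong_mul_of_isUnit (i : σ) {U : MvPowerSeries σ K} (hU : IsUnit U) (H : MvPowerSeries σ K) :
    ordAlong i (U * H) = ordAlong i H := by
  refine le_antisymm ?_ (ordAlong_mul_left_le i U H)
  obtain ⟨u, rfl⟩ := hU
  have h := ordAlong_mul_left_le i (↑u⁻¹ : MvPowerSeries σ K) (↑u * H)
  rwa [← mul_assoc, Units.inv_mul, one_mul] at h

/-- A unit (non-zero constant term) has `ordAlong = 0`. -/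
theorem ordAlong_of_constantCoeff_ne_zero (i : σ) {U : MvPowerSeries σ K} (hU : constantCoeff U ≠ 0) : ordAlong i U = 0 := by
  have h := ordAlong_le (i := i) (H := U) (d := 0) (by rwa [coeff_zero_eq_constantCoeff_apply])
  simpa using h

/-- The coefficients of `x_jⁿ · H`. -/
theorem coeff_X_pow_mul' [DecidableEq σ] (j : σ) (n : ℕ) (H : MvPowerSeries σ K) (d : σ →₀ ℕ) :
    coeff d (X j ^ n * H) = if n ≤ d j then coeff (d - Finsupp.single j n) H else 0 := by
  rw [X_pow_eq, coeff_monomial_mul]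
  by_cases h : n ≤ d j
  · rw [if_pos h, one_mul, if_pos]
    intro l
    rw [Finsupp.single_apply]
    split_ifs with hl
    · subst hl; exact h
    · exact Nat.zero_le _
  · rw [if_neg h, if_neg]
    intro hle
    exact h (by simpa using hle j)

/-- `ordAlong` of `x_iⁿ · H` in the direction `i`: shifted by `n`. -/
theorem ordAlong_X_pow_mul (i : σ) (n : ℕ) (H : MvPowerSeries σ K) : ordAlong i (X i ^ n * H) = n + ordAlong i H := by
  classical
  refine le_antisymm ?_ ?_
  · by_cases hH : H = 0
    · subst hH; simp [ordAlong_eq_top_iff.mpr rfl]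
    obtain ⟨d, hd, hdeq⟩ := exists_coeff_ne_zero_of_ordAlong i hH
    have h : coeff (d + Finsupp.single i n) (X i ^ n * H) ≠ 0 := by
      rw [coeff_X_pow_mul', if_pos (by simp), add_tsub_cancel_right]; exact hd
    refine le_trans (ordAlong_le h) ?_
    rw [← hdeq, Finsupp.add_apply, Finsupp.single_eq_same, Nat.cast_add, add_comm]
  · rw [le_ordAlong_iff]
    intro d hd
    rw [coeff_X_pow_mul'] at hd
    split_ifs at hd with hn
    · have h := ordAlong_le (i := i) hd
      rw [Finsupp.tsub_apply, Finsupp.single_eq_same] at h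
      calc (n : ℕ∞) + ordAlong i H ≤ n + ((d i - n : ℕ) : ℕ∞) := add_le_add le_rfl h
        _ = (d i : ℕ∞) := by rw [← Nat.cast_add]; congr 1; omega
    · exact absurd rfl hd

/-- `ordAlong` of `x_jⁿ · H` in another direction `i ≠ j`: unchanged. -/
theorem ordAlong_X_pow_mul_of_ne {i j : σ} (hij : i ≠ j) (n : ℕ) (H : MvPowerSeries σ K) :
    ordAlong i (X j ^ n * H) = ordAlong i H := by
  classical
  refine le_antisymm ?_ (ordAlong_mul_left_le i _ H)
  by_cases hH : H = 0
  · subst hH; simp [ordAlong_eq_top_iff.mpr rfl]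
  obtain ⟨d, hd, hdeq⟩ := exists_coeff_ne_zero_of_ordAlong i hH
  have h : coeff (d + Finsupp.single j n) (X j ^ n * H) ≠ 0 := by
    rw [coeff_X_pow_mul', if_pos (by simp), add_tsub_cancel_right]; exact hd
  refine le_trans (ordAlong_le h) ?_
  rw [← hdeq, Finsupp.add_apply, Finsupp.single_eq_of_ne hij, add_zero]

/-- A variable is a non-zero series. -/
theorem X_ne_zero'' (i : σ) : (X i : MvPowerSeries σ K) ≠ 0 := by
  intro h
  have h1 := congrArg (coeff (Finsupp.single i 1)) h
  rw [coeff_index_single_self_X, map_zero] at h1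
  exact one_ne_zero h1

/-! ### `ordVarPS H i = (ordAlong i H).toNat` -/

/-- For a non-zero series `ordVarPS` is `ordAlong` (finite). -/
theorem ordVarPS_coe (i : σ) {H : MvPowerSeries σ K} (hH : H ≠ 0) : ((ordVarPS H i : ℕ) : ℕ∞) = ordAlong i H := by
  rw [ordVarPS, ENat.coe_toNat]
  exact fun h => hH (ordAlong_eq_top_iff.mp h)

/-- A support point realising `ordVarPS`. -/
theorem exists_coeff_apply_eq_ordVarPS (i : σ) {H : MvPowerSeries σ K} (hH : H ≠ 0) :
    ∃ d : σ →₀ ℕ, coeff d H ≠ 0 ∧ d i = ordVarPS H i := by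
  obtain ⟨d, hd, hdeq⟩ := exists_coeff_ne_zero_of_ordAlong i hH
  refine ⟨d, hd, ?_⟩
  have h := ordVarPS_coe i hH
  rw [← hdeq] at h
  exact_mod_cast h.symm

/-- Every support point has `i`-exponent `≥ ordVarPS`. -/
theorem ordVarPS_le (i : σ) {H : MvPowerSeries σ K} {d : σ →₀ ℕ} (hd : coeff d H ≠ 0) : ordVarPS H i ≤ d i := by
  have hH : H ≠ 0 := by rintro rfl; exact hd (map_zero _)
  have h := ordAlong_le (i := i) hd
  rw [← ordVarPS_coe i hH] at h
  exact_mod_cast h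

/-- Units do not change `ordVarPS`. -/
theorem ordVarPS_mul_of_isUnit (i : σ) {U : MvPowerSeries σ K} (hU : IsUnit U) (H : MvPowerSeries σ K) :
    ordVarPS (U * H) i = ordVarPS H i := by
  rw [ordVarPS, ordVarPS, ordAlong_mul_of_isUnit i hU]

/-- `ordVarPS` of `x_iⁿ · H` in the direction `i` (`H ≠ 0`). -/
theorem ordVarPS_X_pow_mul (i : σ) (n : ℕ) {H : MvPowerSeries σ K} (hH : H ≠ 0) :
    ordVarPS (X i ^ n * H) i = n + ordVarPS H i := by
  have h1 := ordVarPS_coe i (mul_ne_zero (pow_ne_zero n (X_ne_zero'' i)) hH)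
  rw [ordAlong_X_pow_mul, ← ordVarPS_coe i hH, ← Nat.cast_add] at h1
  exact_mod_cast h1

/-- `ordVarPS` of `x_jⁿ · H` in another direction. -/
theorem ordVarPS_X_pow_mul_of_ne {i j : σ} (hij : i ≠ j) (n : ℕ) (H : MvPowerSeries σ K) :
    ordVarPS (X j ^ n * H) i = ordVarPS H i := by
  rw [ordVarPS, ordVarPS, ordAlong_X_pow_mul_of_ne hij]

/-! ### `degAlongPS H rig free` — the free exponent `α₁` of the highest vertex -/

/-- Unfolding `degAlongPS` with `coeff`. -/
theorem degAlongPS_def (H : MvPowerSeries σ K) (rig free : σ) :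
    degAlongPS H rig free = (⨅ (d : σ →₀ ℕ) (_ : coeff d H ≠ 0 ∧ d rig = ordVarPS H rig), ((d free : ℕ) : ℕ∞)).toNat := rfl

/-- THE HIGHEST VERTEX IS A SUPPORT POINT: for `H ≠ 0` some `d` in the support has `d rig = ord_rig` and `d free = α₁`. -/
theorem exists_vertex {H : MvPowerSeries σ K} (hH : H ≠ 0) (rig free : σ) :
    ∃ d : σ →₀ ℕ, coeff d H ≠ 0 ∧ d rig = ordVarPS H rig ∧ d free = degAlongPS H rig free := by
  obtain ⟨d₀, hd₀, hd₀r⟩ := exists_coeff_apply_eq_ordVarPS rig hH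
  haveI hne : Nonempty {d : σ →₀ ℕ // coeff d H ≠ 0 ∧ d rig = ordVarPS H rig} := ⟨⟨d₀, hd₀, hd₀r⟩⟩
  obtain ⟨⟨d, hd, hdr⟩, h⟩ :=
    ENat.exists_eq_iInf (fun x : {d : σ →₀ ℕ // coeff d H ≠ 0 ∧ d rig = ordVarPS H rig} => ((x.1 free : ℕ) : ℕ∞))
  refine ⟨d, hd, hdr, ?_⟩
  rw [degAlongPS_def, iInf_subtype', ← h, ENat.toNat_coe]

/-- A support point on the lowest rigid row bounds `α₁` from above. -/
theorem degAlongPS_le {H : MvPowerSeries σ K} {rig free : σ} {d : σ →₀ ℕ} (hd : coeff d H ≠ 0)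
    (hdr : d rig = ordVarPS H rig) : degAlongPS H rig free ≤ d free := by
  have h : (⨅ (d : σ →₀ ℕ) (_ : coeff d H ≠ 0 ∧ d rig = ordVarPS H rig), ((d free : ℕ) : ℕ∞)) ≤ (d free : ℕ∞) :=
    iInf₂_le d ⟨hd, hdr⟩
  rw [degAlongPS_def]
  have hfin : (⨅ (d : σ →₀ ℕ) (_ : coeff d H ≠ 0 ∧ d rig = ordVarPS H rig), ((d free : ℕ) : ℕ∞)) ≠ ⊤ :=
    ne_top_of_le_ne_top (ENat.coe_ne_top _) h
  have h' := h
  rw [← ENat.coe_toNat hfin] at h'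
  exact_mod_cast h'

/-- ON THE LOWEST RIGID ROW EVERY FREE EXPONENT IS `≥ α₁`. -/
theorem degAlongPS_le_of_apply_rig_eq {H : MvPowerSeries σ K} {rig free : σ} {d : σ →₀ ℕ} (hd : coeff d H ≠ 0)
    (hdr : d rig = ordVarPS H rig) : degAlongPS H rig free ≤ d free :=
  degAlongPS_le hd hdr

/-- Lower bounds for `α₁`. -/
theorem le_degAlongPS {H : MvPowerSeries σ K} (hH : H ≠ 0) {rig free : σ} {n : ℕ}
    (h : ∀ d : σ →₀ ℕ, coeff d H ≠ 0 → d rig = ordVarPS H rig → n ≤ d free) : n ≤ degAlongPS H rig free := by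
  obtain ⟨d, hd, hdr, hdf⟩ := exists_vertex hH rig free
  rw [← hdf]
  exact h d hd hdr

/-! ### `heightPS` and the monomial criterion -/

/-- `ord_free ≤ α₁`. -/
theorem ordVarPS_le_degAlongPS {H : MvPowerSeries σ K} (hH : H ≠ 0) (rig free : σ) :
    ordVarPS H free ≤ degAlongPS H rig free := by
  obtain ⟨d, hd, -, hdf⟩ := exists_vertex hH rig free
  rw [← hdf]
  exact ordVarPS_le free hd

/-- EVERY SUPPORT POINT LIES ABOVE `(ord₀, ord₁)`: a two-variable series is divisible by `x₀^{ord₀} x₁^{ord₁}`. -/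
theorem X_pow_mul_X_pow_dvd (H : MvPowerSeries (Fin 2) K) :
    X 0 ^ ordVarPS H 0 * X 1 ^ ordVarPS H 1 ∣ H := by
  by_cases hH : H = 0
  · subst hH; exact dvd_zero _
  have h1 : X 1 ^ ordVarPS H 1 ∣ H := by
    rw [X_pow_dvd_iff_le_ordAlong, ← ordVarPS_coe 1 hH]
  obtain ⟨G, hG⟩ := h1
  have hG0 : G ≠ 0 := by rintro rfl; exact hH (by rw [hG, mul_zero])
  have h0 : X 0 ^ ordVarPS H 0 ∣ G := by
    rw [X_pow_dvd_iff_le_ordAlong, ← ordVarPS_coe 0 hG0]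
    have h := ordVarPS_X_pow_mul_of_ne (show (0 : Fin 2) ≠ 1 from zero_ne_one) (ordVarPS H 1) G
    rw [← hG] at h
    rw [h]
  obtain ⟨U, hU⟩ := h0
  refine ⟨U, ?_⟩
  calc H = X 1 ^ ordVarPS H 1 * G := hG
    _ = X 0 ^ ordVarPS H 0 * X 1 ^ ordVarPS H 1 * U := by rw [hU]; ring

/-- In `Fin 2`, given `rig ≠ free`, every index is `free` or `rig`. -/
theorem eq_or_eq_of_ne {rig free : Fin 2} (hrf : rig ≠ free) (l : Fin 2) : l = free ∨ l = rig := by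
  revert hrf
  fin_cases rig <;> fin_cases free <;> fin_cases l <;> decide

/-- The two-variable monomial divisibility with the roles named. -/
theorem X_pow_mul_X_pow_dvd' (H : MvPowerSeries (Fin 2) K) {rig free : Fin 2} (hrf : rig ≠ free) :
    X free ^ ordVarPS H free * X rig ^ ordVarPS H rig ∣ H := by
  rcases eq_or_eq_of_ne hrf 0 with h0 | h0
  · have h1 : (1 : Fin 2) = rig := by
      rcases eq_or_eq_of_ne hrf 1 with h | h
      · exact absurd (h.trans h0.symm) one_ne_zero
      · exact h
    subst h0; subst h1
    exact X_pow_mul_X_pow_dvd H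
  · have h1 : (1 : Fin 2) = free := by
      rcases eq_or_eq_of_ne hrf 1 with h | h
      · exact h
      · exact absurd (h.trans h0.symm) one_ne_zero
    subst h0; subst h1
    rw [mul_comm]
    exact X_pow_mul_X_pow_dvd H

/-- The coefficient of `x_free^a x_rig^b · U` at `(a, b)` is `U(0)`. -/
theorem coeff_vertex_monomial {rig free : Fin 2} (a b : ℕ) (U : MvPowerSeries (Fin 2) K) :
    coeff (Finsupp.single free a + Finsupp.single rig b) (X free ^ a * X rig ^ b * U) = constantCoeff U := by
  classical
  rw [X_pow_eq, X_pow_eq, monomial_mul_monomial, one_mul, coeff_monomial_mul, if_pos le_rfl, tsub_self, one_mul,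
    coeff_zero_eq_constantCoeff_apply]

/-- THE MONOMIAL CRITERION (two variables, given coordinates): for `H ≠ 0` and `rig ≠ free`, `height = 0` iff
`H = x_free^{ord_free} · x_rig^{ord_rig} · U` with `U(0) ≠ 0`. -/
theorem heightPS_eq_zero_iff {H : MvPowerSeries (Fin 2) K} (hH : H ≠ 0) {rig free : Fin 2} (hrf : rig ≠ free) :
    heightPS H rig free = 0 ↔ ∃ U : MvPowerSeries (Fin 2) K, constantCoeff U ≠ 0 ∧
      H = X free ^ ordVarPS H free * X rig ^ ordVarPS H rig * U := by
  classical
  obtain ⟨a, ha⟩ : ∃ a, ordVarPS H free = a := ⟨_, rfl⟩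
  obtain ⟨b, hb⟩ : ∃ b, ordVarPS H rig = b := ⟨_, rfl⟩
  have hvert : ∀ d : Fin 2 →₀ ℕ, d free = a → d rig = b → d = Finsupp.single free a + Finsupp.single rig b := by
    intro d hdf hdr
    ext l
    rcases eq_or_eq_of_ne hrf l with rfl | rfl
    · rw [Finsupp.add_apply, Finsupp.single_eq_same, Finsupp.single_eq_of_ne hrf.symm, add_zero, hdf]
    · rw [Finsupp.add_apply, Finsupp.single_eq_of_ne hrf, Finsupp.single_eq_same, zero_add, hdr]
  obtain ⟨U, hU⟩ := X_pow_mul_X_pow_dvd' H hrf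
  rw [ha, hb] at hU ⊢
  constructor
  · intro h0
    rw [heightPS, Nat.sub_eq_zero_iff_le, ha] at h0
    have heq : degAlongPS H rig free = a := le_antisymm h0 (ha ▸ ordVarPS_le_degAlongPS hH rig free)
    obtain ⟨d, hd, hdr, hdf⟩ := exists_vertex hH rig free
    rw [heq] at hdf
    rw [hb] at hdr
    refine ⟨U, ?_, hU⟩
    rw [← coeff_vertex_monomial (rig := rig) (free := free) a b U, ← hU, ← hvert d hdf hdr]
    exact hd
  · rintro ⟨V, hV, hHV⟩
    rw [heightPS, Nat.sub_eq_zero_iff_le, ha]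
    have hd : coeff (Finsupp.single free a + Finsupp.single rig b) H ≠ 0 := by
      rw [hHV, coeff_vertex_monomial]; exact hV
    have h := degAlongPS_le (rig := rig) (free := free) hd
      (by rw [Finsupp.add_apply, Finsupp.single_eq_of_ne hrf, Finsupp.single_eq_same, zero_add, hb])
    rwa [Finsupp.add_apply, Finsupp.single_eq_same, Finsupp.single_eq_of_ne hrf.symm, add_zero] at h

end InsepNewton

end Summit.ResolutionOfSingularities.ResolutionOfSingularities.Theorems
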